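import Mathlib
import Summits.MatrixMultiplication.MatrixMultiplication.Theorems.SnSubsetDichotomyThresholdSubsetTriplesChainDefs
import Summits.MatrixMultiplication.MatrixMultiplication.Theorems.SnSubsetDichotomyThresholdSubsetTriplesStubCard
import Summits.MatrixMultiplication.MatrixMultiplication.Theorems.SnSubsetDichotomyThresholdSubsetTriplesPairFactorisation

/-!
# `SnSubsetDichotomy.ThresholdSubsetTriples` — stub `stub_pairFactorisation`, counting proof (siege k3)

Crux `stmt-MatrixMultiplication-10882` (`ThresholdSubsetTriples`, route `SnSubsetDichotomy`), line
`interleaved-subsignature-ascent`, registered stub `stub_pairFactorisation` (census c3a): for every level set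
`L ⊆ {0,…,n−1}` the two complementary OWNER chain classes `S_A = subsig (ownerSystem L)` (all star letters
`swap d k`, `d ≤ k`, at the levels `k ∈ L`; the identity letter only elsewhere) and `S_B = subsig (ownerSystem Lᶜ)`
factorise `S_n` EXACTLY: every permutation is `s_A⁻¹ s_B` for exactly one pair.

This file is a second proof of the registered stub (the line's own copy is
`…Theorems.ThresholdSubsetTriples.stub_pairFactorisation` in `SnSubsetDichotomyThresholdSubsetTriplesPairFactorisation`,
which proves existence AND uniqueness by two parallel peeling inductions).  Here the stub is REDUCED TO LANDED
LEMMAS of the crux and assembled by COUNTING: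

* existence — the pair map `(a, b) ↦ a⁻¹ b` is onto the permutations fixing the points `≥ m` already on the
  lower classes `subsigBelow _ m` (`pair_surj_subsigBelow`): induction on `m`, each step being the landed
  one-level lemmas `pair_step_surj` (peel the top letter of the class owning level `m`) and `pair_flip_surj`
  (invert the pair when the owner is `A`);
* the census's quantitative content as a named identity — `|S_A| · |S_B| = n!` (`card_subsig_ownerSystem_mul_compl`):
  by the landed exact size formula `stub_card` (`|subsig D| = ∏_k |D k|`) and `|D^A_k| · |D^B_k| = k + 1` at every
  level (exactly one of the two systems owns level `k`), `∏_{k<n} (k+1) = n!`;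
* uniqueness — a surjection `S_A × S_B → S_n` between finite sets of the same size `n!` is injective
  (`Finset.injOn_of_surjOn_of_card_le`), so no letter-by-letter cancellation is needed.

Mathlib + the three landed line files only (`…ChainDefs`, `…StubCard`, `…PairFactorisation`).
-/

-- `Summit.<Summit>.<Problem>` is the tree's mandated summit-side namespace; for this single-conjunct summit the
-- two components coincide, so the file silences `dupNamespace` (same as the vocabulary file it imports).
set_option linter.dupNamespace false
set_option autoImplicit false

namespace Summit.MatrixMultiplication.MatrixMultiplication.Theorems.ThresholdSubsetTriples.PairFactorisationK3

open scoped Pointwise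

variable {n : ℕ}

/-! ## Level sizes of the two owner systems -/

/-- At a level it owns, the owner system has all `k + 1` letters `d ≤ k`. -/
theorem card_ownerSystem_of_mem {L : Finset (Fin n)} {k : Fin n} (hk : k ∈ L) :
    (ownerSystem L k).card = (k : ℕ) + 1 := by
  rw [ownerSystem_of_mem hk]
  have h : Finset.univ.filter (fun d : Fin n => d ≤ k) = Finset.Iic k := by
    ext d
    simp
  rw [h, Fin.card_Iic]

/-- At a level it does not own, the owner system has exactly one letter (the identity letter). -/
theorem card_ownerSystem_of_not_mem {L : Finset (Fin n)} {k : Fin n} (hk : k ∉ L) :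
    (ownerSystem L k).card = 1 := by
  rw [ownerSystem_of_not_mem hk, Finset.card_singleton]

/-- Level pair-efficiency `1`: exactly one of the two complementary owner systems owns level `k`, so
`|D^A_k| · |D^B_k| = k + 1`. -/
theorem card_ownerSystem_mul_compl (L : Finset (Fin n)) (k : Fin n) :
    (ownerSystem L k).card * (ownerSystem Lᶜ k).card = (k : ℕ) + 1 := by
  by_cases hk : k ∈ L
  · have hk' : k ∉ Lᶜ := fun h => (Finset.mem_compl.1 h) hk
    rw [card_ownerSystem_of_mem hk, card_ownerSystem_of_not_mem hk', mul_one]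
  · have hk' : k ∈ Lᶜ := Finset.mem_compl.2 hk
    rw [card_ownerSystem_of_not_mem hk, card_ownerSystem_of_mem hk', one_mul]

/-- **`|S_A| · |S_B| = n!`** for the complementary owner chain classes (census c3a §1, quantitative form):
the landed exact size formula `stub_card` and `∏_{k<n} (k+1) = n!`. -/
theorem card_subsig_ownerSystem_mul_compl (L : Finset (Fin n)) :
    (subsig (ownerSystem L)).card * (subsig (ownerSystem Lᶜ)).card = n.factorial := by
  rw [stub_card _ (ownerSystem_isDirectionSystem L), stub_card _ (ownerSystem_isDirectionSystem Lᶜ),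
    ← Finset.prod_mul_distrib]
  simp_rw [card_ownerSystem_mul_compl]
  rw [Fin.prod_univ_eq_prod_range (fun i => i + 1) n]
  exact Finset.prod_range_add_one_eq_factorial n

/-! ## Existence: the pair map is onto (peeling, from the landed one-level lemmas) -/

/-- Surjective half of the factorisation on the lower classes: every permutation fixing the points `≥ m`
is `a⁻¹ b` with `a ∈ subsigBelow (ownerSystem L) m`, `b ∈ subsigBelow (ownerSystem Lᶜ) m` (`m ≤ n`).
Induction on `m`; the step is the landed `pair_step_surj` for the class owning level `m` (the other class
is trivial there), after flipping the pair by inversion (`pair_flip_surj`) when the owner is `A`. -/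
theorem pair_surj_subsigBelow (L : Finset (Fin n)) :
    ∀ m : ℕ, m ≤ n → ∀ σ : Equiv.Perm (Fin n), (∀ p : Fin n, m ≤ (p : ℕ) → σ p = p) →
      ∃ a ∈ subsigBelow (ownerSystem L) m, ∃ b ∈ subsigBelow (ownerSystem Lᶜ) m, a⁻¹ * b = σ := by
  intro m
  induction m with
  | zero =>
    intro _ σ hσ
    refine ⟨1, by simp [subsigBelow_zero], 1, by simp [subsigBelow_zero], ?_⟩
    rw [inv_one, one_mul]
    ext p
    exact congrArg Fin.val (hσ p (Nat.zero_le _)).symm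
  | succ m ih =>
    intro hm
    have hmn : m < n := Nat.lt_of_succ_le hm
    have ihS := ih hmn.le
    set t : Fin n := ⟨m, hmn⟩ with ht
    -- the lower classes fix the points `≥ m`
    have fixA : ∀ a ∈ subsigBelow (ownerSystem L) m, ∀ p : Fin n, t ≤ p → a p = p :=
      fun a ha p hp => subsigBelow_apply_of_le _ (ownerSystem_isDirectionSystem L) m a ha p hp
    have fixB : ∀ b ∈ subsigBelow (ownerSystem Lᶜ) m, ∀ p : Fin n, t ≤ p → b p = p :=
      fun b hb p hp => subsigBelow_apply_of_le _ (ownerSystem_isDirectionSystem Lᶜ) m b hb p hp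
    rw [subsigBelow_succ_of_lt _ hmn, subsigBelow_succ_of_lt _ hmn]
    -- thresholds: `m + 1 ≤ p` iff `t < p`, and `m ≤ p` iff `t ≤ p`
    have thr : ∀ p : Fin n, (m + 1 ≤ (p : ℕ) ↔ t < p) := fun p => by
      rw [Fin.lt_def]; exact Iff.rfl
    have thr' : ∀ p : Fin n, (m ≤ (p : ℕ) ↔ t ≤ p) := fun p => by
      rw [Fin.le_def]
    by_cases hL : t ∈ L
    · -- `A` owns level `m`, `B` is trivial there: flip, peel, flip back
      have hBt : (⟨m, hmn⟩ : Fin n) ∉ Lᶜ := fun h => (Finset.mem_compl.1 h) hL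
      rw [ownerSystem_of_mem hL, ownerSystem_of_not_mem hBt, starPiece_singleton_self,
        Finset.singleton_one, one_mul]
      have stepS := pair_step_surj (subsigBelow (ownerSystem Lᶜ) m) (subsigBelow (ownerSystem L) m) t fixB
        (fun σ hσ => pair_flip_surj _ _ m ihS σ (fun p hp => hσ p ((thr' p).2 hp)))
      intro σ hσ
      have hσ' : ∀ p : Fin n, t < p → σ⁻¹ p = p := by
        intro p hp
        rw [Equiv.Perm.inv_eq_iff_eq]
        exact (hσ p ((thr p).2 hp)).symm
      obtain ⟨b, hb, a, ha, hba⟩ := stepS σ⁻¹ hσ'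
      refine ⟨a, ha, b, hb, ?_⟩
      have h := congrArg (fun π : Equiv.Perm (Fin n) => π⁻¹) hba
      simpa using h
    · -- `B` owns level `m`: peel directly
      have hBt : (⟨m, hmn⟩ : Fin n) ∈ Lᶜ := Finset.mem_compl.2 hL
      rw [ownerSystem_of_not_mem hL, ownerSystem_of_mem hBt, starPiece_singleton_self,
        Finset.singleton_one, one_mul]
      have stepS := pair_step_surj (subsigBelow (ownerSystem L) m) (subsigBelow (ownerSystem Lᶜ) m) t fixA
        (fun σ hσ => ihS σ (fun p hp => hσ p ((thr' p).2 hp)))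
      exact fun σ hσ => stepS σ (fun p hp => hσ p ((thr p).2 hp))

/-- The pair map `(a, b) ↦ a⁻¹ b` sends `S_A × S_B` ONTO `S_n`. -/
theorem pairMap_surjOn (L : Finset (Fin n)) :
    Set.SurjOn (fun p : Equiv.Perm (Fin n) × Equiv.Perm (Fin n) => p.1⁻¹ * p.2)
      ↑(subsig (ownerSystem L) ×ˢ subsig (ownerSystem Lᶜ)) ↑(Finset.univ : Finset (Equiv.Perm (Fin n))) := by
  intro σ _
  obtain ⟨a, ha, b, hb, hab⟩ :=
    pair_surj_subsigBelow L n le_rfl σ (fun p hp => absurd p.isLt (not_lt.2 hp))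
  exact ⟨(a, b), Finset.mem_coe.2 (Finset.mk_mem_product ha hb), hab⟩

/-- … and is therefore INJECTIVE on `S_A × S_B`, by counting: `|S_A × S_B| = n! = |S_n|`
(`card_subsig_ownerSystem_mul_compl`, `Finset.injOn_of_surjOn_of_card_le`). -/
theorem pairMap_injOn (L : Finset (Fin n)) :
    Set.InjOn (fun p : Equiv.Perm (Fin n) × Equiv.Perm (Fin n) => p.1⁻¹ * p.2)
      ↑(subsig (ownerSystem L) ×ˢ subsig (ownerSystem Lᶜ)) := by
  refine Finset.injOn_of_surjOn_of_card_le _ (fun p _ => Finset.mem_coe.2 (Finset.mem_univ _))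
    (pairMap_surjOn L) (le_of_eq ?_)
  rw [Finset.card_product, card_subsig_ownerSystem_mul_compl, Finset.card_univ, Fintype.card_perm,
    Fintype.card_fin]

/-- **Exact pair factorisation (registered stub `stub_pairFactorisation` of crux stmt-MatrixMultiplication-10882,
census c3a; counting proof).**  For every level set `L`, every permutation of `Fin n` is `s_A⁻¹ s_B` for exactly
ONE pair `(s_A, s_B) ∈ subsig (ownerSystem L) × subsig (ownerSystem Lᶜ)`: existence by peeling the levels
(`pair_surj_subsigBelow`), uniqueness because a surjection between finite sets of equal size `n!`
(`card_subsig_ownerSystem_mul_compl`) is a bijection. [folklore-type; proved here] -/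
theorem stub_pairFactorisation {n : ℕ} (L : Finset (Fin n)) (σ : Equiv.Perm (Fin n)) :
    ∃! p : Equiv.Perm (Fin n) × Equiv.Perm (Fin n),
      p.1 ∈ subsig (ownerSystem L) ∧ p.2 ∈ subsig (ownerSystem Lᶜ) ∧ p.1⁻¹ * p.2 = σ := by
  obtain ⟨p, hp, hpσ⟩ := pairMap_surjOn L (Finset.mem_coe.2 (Finset.mem_univ σ))
  have hp' := Finset.mem_product.1 (Finset.mem_coe.1 hp)
  refine ⟨p, ⟨hp'.1, hp'.2, hpσ⟩, ?_⟩
  rintro q ⟨hq1, hq2, hqσ⟩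
  exact pairMap_injOn L (Finset.mem_coe.2 (Finset.mk_mem_product hq1 hq2)) hp (hqσ.trans hpσ.symm)

end Summit.MatrixMultiplication.MatrixMultiplication.Theorems.ThresholdSubsetTriples.PairFactorisationK3
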